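import Literature.NumberTheory.Automorphic.Liu2021.LemD1AsPrintedIndexedNonVacuityCharacterDecisionAllRanksAbelianizationSplit
import HarnessLib

/-!
# [Liu2021, App. D Lemma D.1 (3)] bookkeeping — CONTINUITY of the factorisation through `det`: at a non-split place
# `det : U(V)(F_v) ↠ E_v¹` has a CONTINUOUS section (quasi-symmetries), so continuous characters of `U(V)(F_v)` are EXACTLY the
# continuous characters of `E_v¹` composed with `det`

Reproduction ∕ bookkeeping (Literature, THEOREMS ONLY: no definition, no record, no named fact, no `sorry`; nothing is
asserted about Liu's oscillator representations or about the tree's constructed local Weil carriers).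

Sequel of ✔ `…CharacterDecisionAllRanksAbelianization` ∕ ✔ `…AbelianizationSplit` (every homomorphism `Ψ : S.U →* A` to a commutative group is
`ψ ∘ det` for a UNIQUE `ψ : S.normOne →* A`; place model `S = LemD1OfPlace.standingData` of [Liu2021, App. D §D.1]).  The carriers of the
[Lem. D.1] bookkeeping are smooth, their one-dimensional constituents CONTINUOUS characters; THIS FILE puts the factorisation in the topological
category:

* §1 **`exists_continuous_det_section`** — at a NON-SPLIT place (`E_v = E ⊗_F F_v` a field), for EVERY `N ≥ 2` and EVERY hermitian
  non-degenerate `J`, there is a CONTINUOUS map `s : S.normOne → S.U` with `det (s z) = z`: `s z` is the quasi-symmetry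
  `Q(a, z) = 1 + ((z − 1)/⟨a, a⟩)·⟨a, ·⟩ a` of the general-rank engine (✔ `UnitaryIsotropic.quasi_isometry`, `det_quasi`, `quasi_mul_quasi`,
  [Dieudonne1971GroupesClassiques, Chap. II §4]) along a fixed anisotropic vector `a`, an isometry of determinant `z` with inverse `Q(a, z̄)`,
  whose matrix is affine in `z`.
* §2 **`continuous_comp_det`** (EVERY place: `Ψ = ψ ∘ det` is continuous when `ψ` is — `det` is continuous) and **`continuous_of_factor`**
  (non-split: `ψ` is continuous when `Ψ` is — `ψ = Ψ ∘ s`).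
* §3 the headline, with ✔ the siblings' uniqueness (`N ≥ 3`): **`existsUnique_continuous_normOne_factor_of_diagonal`** (ANY quadratic `E/F`,
  diagonal `J`) and **`existsUnique_continuous_normOne_factor_of_isCMField`** (CM rows, ANY hermitian `J_N`): at a non-split place, for every
  CONTINUOUS `Ψ : U(V)(F_v) →* A` there is a UNIQUE `ψ : E_v¹ →* A` with `Ψ = ψ ∘ det`, and it is CONTINUOUS — «continuous characters of
  `U(V)(F_v)`» = «continuous characters of `E_v¹`» through `det`.

What this does NOT give: the continuous section at SPLIT places (there `U(V)(F_v) ≅ GL_N(E_w)` and `u ↦ diag(u, 1, …, 1)` would serve; not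
written); openness of `det`; carriers of dimension `> 1`; Lem. D.1 itself.  HC_CM is NOT proved.

Cell pub-hodgecm2 (COR-CM), audit class of the END rows `hD1''` ∕ `hD3`; seat prover-pub-hodgecm2-b10.

References: [Liu2021] Y. Liu, *Fourier–Jacobi cycles and arithmetic relative trace formula*, Camb. J. Math. 9 (2021) =
arXiv:2102.11518, App. D §D.1 (l. 5213–5221), Lemma D.1 (3) (l. 5233); [Dieudonne1971GroupesClassiques] J. Dieudonné, *La géométrie
des groupes classiques*, 3e éd. (1971), Chap. II §§4–5; [Mok2014] C. P. Mok, Mem. AMS 235 (2015), §1 Notation p. 5.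
-/

noncomputable section

open scoped Matrix MatrixGroups
open NumberField IsDedekindDomain
open Literature.RepresentationTheory
open Literature.RepresentationTheory.Liu2021 (OscillatorStandingData)
open Literature.NumberTheory.GaloisRepresentations (HeckeCharacter)

namespace Literature.NumberTheory.Automorphic.Liu2021.LemD1IndexedNonVacuityCharacterDecisionAllRanksAbelianizationContinuous

open UnitaryGroup
open LemD1IndexedNonVacuityCharacterDecisionAllRanksAbelianization (existsUnique_normOne_factor_of_diagonal
  existsUnique_normOne_factor_of_isCMField det_comp_subtype_mem_normOne)

/-! ## §0 The engine's matrix dress over a field (private copies of ✔ `UnitaryIsotropicAbelianization` §2) -/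

section Field

variable {K : Type*} [Field K] {σ : K →+* K} {n : Type*} [Fintype n] [DecidableEq n]

/-- The sesquilinear form of `J`: `B_J x y = ᵗσ(x) J y`. [folklore] -/
private theorem toLinearMapₛₗ₂'_apply_eq (J : Matrix n n K) (x y : n → K) :
    Matrix.toLinearMapₛₗ₂' K σ (RingHom.id K) J x y = dotProduct (fun i => σ (x i)) (J.mulVec y) := by
  rw [Matrix.toLinearMapₛₗ₂'_apply]
  simp only [RingHom.id_apply, smul_eq_mul, dotProduct, Matrix.mulVec, Finset.mul_sum]
  exact Finset.sum_congr rfl fun i _ => Finset.sum_congr rfl fun j _ => by ring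

/-- `B_J (M x) (M y) = ᵗσ(x) (ᵗσ(M) J M) y`. [folklore] -/
private theorem form_toLin' (J M : Matrix n n K) (x y : n → K) :
    Matrix.toLinearMapₛₗ₂' K σ (RingHom.id K) J (Matrix.toLin' M x) (Matrix.toLin' M y) =
      dotProduct (fun i => σ (x i)) (((M.map σ).transpose * J * M).mulVec y) := by
  rw [toLinearMapₛₗ₂'_apply_eq, Matrix.toLin'_apply, Matrix.toLin'_apply]
  have h1 : (fun i => σ ((M.mulVec x) i)) = (M.map σ).mulVec (fun i => σ (x i)) := by
    funext i
    rw [RingHom.map_mulVec]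
    rfl
  rw [h1, ← Matrix.vecMul_transpose, ← Matrix.dotProduct_mulVec, Matrix.mulVec_mulVec, Matrix.mulVec_mulVec]

omit [Fintype n] in
/-- `σ` applied to `Pi.single i 1` gives it back. [folklore] -/
private theorem sigma_single (i : n) : (fun k => σ (Pi.single (M := fun _ => K) i (1 : K) k)) = Pi.single i 1 := by
  funext k
  by_cases h : k = i
  · subst h; rw [Pi.single_eq_same, map_one]
  · rw [Pi.single_eq_of_ne h, map_zero]

/-- `B_J` is hermitian when `J` is (`σ` an involution). [folklore] -/
private theorem form_hermitian (hσ : ∀ x : K, σ (σ x) = x) (J : Matrix n n K) (hJh : (J.map σ).transpose = J)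
    (x y : n → K) :
    σ (Matrix.toLinearMapₛₗ₂' K σ (RingHom.id K) J x y) = Matrix.toLinearMapₛₗ₂' K σ (RingHom.id K) J y x := by
  have hJ' : ∀ i j, σ (J i j) = J j i := by
    intro i j
    have h := congrFun (congrFun hJh j) i
    rw [Matrix.transpose_apply, Matrix.map_apply] at h
    exact h
  rw [toLinearMapₛₗ₂'_apply_eq, toLinearMapₛₗ₂'_apply_eq]
  simp only [dotProduct, Matrix.mulVec, map_sum, map_mul, hσ, hJ', Finset.mul_sum]
  rw [Finset.sum_comm]
  exact Finset.sum_congr rfl fun i _ => Finset.sum_congr rfl fun j _ => by ring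

/-- `B_J` is non-degenerate when `det J ≠ 0`. [folklore] -/
private theorem form_nondegenerate (hσ : ∀ x : K, σ (σ x) = x) (J : Matrix n n K) (hJdet : J.det ≠ 0) (x : n → K)
    (hx : ∀ y, Matrix.toLinearMapₛₗ₂' K σ (RingHom.id K) J x y = 0) : x = 0 := by
  have hv : Matrix.vecMul (fun i => σ (x i)) J = 0 := by
    funext j
    have := hx (Pi.single j 1)
    rwa [toLinearMapₛₗ₂'_apply_eq, Matrix.dotProduct_mulVec, dotProduct_single, mul_one] at this
  have h0 := Matrix.eq_zero_of_vecMul_eq_zero hJdet hv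
  funext i
  have hi := congrFun h0 i
  simp only [Pi.zero_apply] at hi
  rw [← hσ (x i), hi, map_zero]
  rfl

/-- A non-zero non-degenerate hermitian space (involution with `σ θ₀ = −θ₀ ≠ 0`, `2 ≠ 0`) has an anisotropic vector. [folklore] -/
private theorem exists_anisotropic {V : Type*} [AddCommGroup V] [Module K V] (B : V →ₛₗ[σ] V →ₗ[K] K)
    (hB : ∀ x y, σ (B x y) = B y x) (hBnd : ∀ x, (∀ y, B x y = 0) → x = 0) {θ₀ : K} (hθ : σ θ₀ = -θ₀) (hθ0 : θ₀ ≠ 0)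
    (h2 : (2 : K) ≠ 0) (hne : ∃ w : V, w ≠ 0) : ∃ a : V, B a a ≠ 0 := by
  by_contra hall
  push Not at hall
  obtain ⟨w, hw⟩ := hne
  refine hw (hBnd w fun y => ?_)
  have h1 := hall (w + y)
  have h2' := hall (θ₀ • w + y)
  simp only [map_add, LinearMap.map_smulₛₗ, map_smul, LinearMap.add_apply, LinearMap.smul_apply, smul_eq_mul, hall w,
    hall y, hθ, (hB w y).symm] at h1 h2'
  have : (2 * θ₀) * B w y = 0 := by linear_combination θ₀ * h1 - h2'
  exact (mul_eq_zero.1 this).resolve_left (mul_ne_zero h2 hθ0)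

/-- An `End`-level isometry of `B_J` has a `J`-unitary matrix: `ᵗσ(M) J M = J` for `M = toMatrix' φ`. [folklore] -/
private theorem unitary_of_isometry (J : Matrix n n K) (φ : Module.End K (n → K))
    (hφ : ∀ x y, Matrix.toLinearMapₛₗ₂' K σ (RingHom.id K) J (φ x) (φ y) = Matrix.toLinearMapₛₗ₂' K σ (RingHom.id K) J x y) :
    ((LinearMap.toMatrix' φ).map σ).transpose * J * LinearMap.toMatrix' φ = J := by
  have hM : ∀ x y, Matrix.toLinearMapₛₗ₂' K σ (RingHom.id K) J (Matrix.toLin' (LinearMap.toMatrix' φ) x)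
      (Matrix.toLin' (LinearMap.toMatrix' φ) y) = Matrix.toLinearMapₛₗ₂' K σ (RingHom.id K) J x y := by
    rw [Matrix.toLin'_toMatrix']; exact hφ
  ext i j
  have h := hM (Pi.single i 1) (Pi.single j 1)
  rw [form_toLin', toLinearMapₛₗ₂'_apply_eq, sigma_single, single_dotProduct, single_dotProduct, one_mul,
    one_mul, Matrix.mulVec_single_one, Matrix.mulVec_single_one, Matrix.col_apply, Matrix.col_apply] at h
  exact h

/-- **The quasi-symmetry family in matrix form, inverse-free statement** (generic field `K` with `2 ≠ 0`, involution `σ` with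
`σ θ₀ = −θ₀ ≠ 0`, hermitian non-degenerate `J` of non-zero size): there are a matrix `T₀` and a scalar `q` such that
`M(μ) = 1 + ((μ − 1) q) • T₀` satisfies `M(μ) M(μ') = M(μ μ')`, `det M(μ) = μ`, and `ᵗσ(M(μ)) J M(μ) = J` whenever `σ μ · μ = 1`
(`T₀` = the matrix of `⟨a, ·⟩ a`, `q = ⟨a, a⟩⁻¹` for an anisotropic `a`; ✔ `UnitaryIsotropic.quasi_isometry ∕ det_quasi ∕ quasi_mul_quasi`).
[cite: Dieudonne1971GroupesClassiques, Chap. II §4] -/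
private theorem exists_quasi_family [Nonempty n] (hσ : ∀ x : K, σ (σ x) = x) {θ₀ : K} (hθ : σ θ₀ = -θ₀) (hθ0 : θ₀ ≠ 0)
    (h2 : (2 : K) ≠ 0) (J : Matrix n n K) (hJh : (J.map σ).transpose = J) (hJdet : J.det ≠ 0) :
    ∃ (T₀ : Matrix n n K) (q : K),
      (∀ μ μ' : K, (1 + ((μ - 1) * q) • T₀) * (1 + ((μ' - 1) * q) • T₀) = 1 + ((μ * μ' - 1) * q) • T₀) ∧
      (∀ μ : K, (1 + ((μ - 1) * q) • T₀).det = μ) ∧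
      (∀ μ : K, σ μ * μ = 1 → ((1 + ((μ - 1) * q) • T₀).map σ).transpose * J * (1 + ((μ - 1) * q) • T₀) = J) := by
  classical
  obtain ⟨B, hBdef⟩ : ∃ B, B = Matrix.toLinearMapₛₗ₂' K σ (RingHom.id K) J := ⟨_, rfl⟩
  have hB : ∀ x y, σ (B x y) = B y x := by subst hBdef; exact form_hermitian hσ J hJh
  have hBnd : ∀ x, (∀ y, B x y = 0) → x = 0 := by subst hBdef; exact form_nondegenerate hσ J hJdet
  obtain ⟨i⟩ := ‹Nonempty n›
  have hne : ∃ w : n → K, w ≠ 0 := by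
    refine ⟨Pi.single i (1 : K), fun h => ?_⟩
    have h1 : Pi.single (M := fun _ => K) i (1 : K) i = 0 := by rw [h]; rfl
    rw [Pi.single_eq_same] at h1
    exact one_ne_zero h1
  obtain ⟨a, ha⟩ := exists_anisotropic B hB hBnd hθ hθ0 h2 hne
  have hQmat : ∀ μ : K, LinearMap.toMatrix' ((1 : Module.End K (n → K)) + ((μ - 1) * (B a a)⁻¹) • (B a).smulRight a) =
      1 + ((μ - 1) * (B a a)⁻¹) • LinearMap.toMatrix' ((B a).smulRight a) := by
    intro μ
    rw [map_add, map_smul, LinearMap.toMatrix'_one]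
  refine ⟨LinearMap.toMatrix' ((B a).smulRight a), (B a a)⁻¹, fun μ μ' => ?_, fun μ => ?_, fun μ hμ => ?_⟩
  · rw [← hQmat, ← hQmat, ← hQmat, ← LinearMap.toMatrix'_mul, UnitaryIsotropic.quasi_mul_quasi B a ha μ μ']
  · rw [← hQmat, LinearMap.det_toMatrix']
    exact UnitaryIsotropic.det_quasi B a ha μ
  · rw [← hQmat]
    refine unitary_of_isometry J _ fun x y => ?_
    have h := UnitaryIsotropic.quasi_isometry B hB a ha μ hμ x y
    rw [hBdef] at h ⊢
    exact h

end Field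

/-! ## §1 NON-SPLIT place: a CONTINUOUS section of `det : U(V)(F_v) ↠ E_v¹` by quasi-symmetries -/

section PlaceModel

variable {F : Type} (E : Type) [Field F] [NumberField F] [Field E] [NumberField E] [Algebra F E]
  [Algebra.IsQuadraticExtension F E] (v : HeightOneSpectrum (𝓞 F)) (c : E ≃ₐ[F] E)
  {δ : E} (hcδ : c δ = -δ) (hδ : δ ≠ 0)
  (N : ℕ) (J : Matrix (Fin N) (Fin N) E) (hN : 2 ≤ N) (hJh : (J.map c)ᵀ = J) (hJdet : J.det ≠ 0)

omit [NumberField F] [Algebra.IsQuadraticExtension F E] in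
include hcδ hδ in
/-- `c ≠ 1` (`c δ = −δ ≠ δ`); copy of the siblings' private lemma. [folklore] -/
private theorem hc_of_delta : c ≠ 1 := by
  rintro rfl
  rw [AlgEquiv.one_apply] at hcδ
  have h2 : (2 : E) * δ = 0 := by linear_combination hcδ
  exact hδ ((mul_eq_zero.mp h2).resolve_left two_ne_zero)

include hcδ hδ hN hJh hJdet in
/-- **A CONTINUOUS section of `det : U(V)(F_v) ↠ E_v¹` at a NON-SPLIT place** (every `N ≥ 2`, every hermitian non-degenerate `J`): a continuous
`s : S.normOne → S.U` with `det (s z) = z` — the quasi-symmetries `Q(a, z)` along a fixed anisotropic vector `a` of `(E_vᴺ, J ⊗ 1)` (an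
isometry of determinant `z`, inverse `Q(a, z̄)`, matrix `1 + ((z − 1)/⟨a,a⟩)·T₀` affine in `z`). [cite: Dieudonne1971GroupesClassiques, Chap. II §4]
[cite: Mok2014, §1 Notation p. 5] -/
theorem exists_continuous_det_section (w : PlacesOver E v) (hw : c • w.1 = w.1) :
    ∃ s : (LemD1OfPlace.standingData E v c N J hcδ hδ hN hJh hJdet).normOne →
        (LemD1OfPlace.standingData E v c N J hcδ hδ hN hJh hJdet).U,
      Continuous s ∧ ∀ z, Matrix.GeneralLinearGroup.det (s z : GL (Fin N) (LocalRing E v)) = (z : (LocalRing E v)ˣ) := by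
  classical
  have hc : c ≠ 1 := hc_of_delta E c hcδ hδ
  letI : Field (LocalRing E v) := (LocalRing.isField_of_smul_eq c hc w hw).toField
  -- the involution, `θ₀ = δ ⊗ 1`, `2 ≠ 0`
  have hσ : ∀ x, conjLocal E c v (conjLocal E c v x) = x := LemD1OfPlace.conjLocal_conjLocal_apply E v c hcδ hδ
  have hθ : conjLocal E c v (algebraMap E (LocalRing E v) δ) = -algebraMap E (LocalRing E v) δ := by
    rw [conjLocal_algebraMap, hcδ, map_neg]
  have hθ0 : algebraMap E (LocalRing E v) δ ≠ 0 := (_root_.map_ne_zero _).2 hδ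
  have h2 : (2 : LocalRing E v) ≠ 0 := by
    rw [← map_ofNat (algebraMap E (LocalRing E v)) 2]
    exact (_root_.map_ne_zero _).2 two_ne_zero
  -- the local Gram matrix `J ⊗ 1` is hermitian and non-degenerate
  obtain ⟨Jv, hJv⟩ : ∃ Jv, Jv = J.map (algebraMap E (LocalRing E v)) := ⟨_, rfl⟩
  have hgram : (adelicForm E N J).map (adeleToLocal E v) = Jv := by rw [hJv]; exact LemD1OfPlace.localGram_eq E v N J
  have hJvh : (Jv.map (conjLocal E c v))ᵀ = Jv := by
    have hcφ : (conjLocal E c v) ∘ (algebraMap E (LocalRing E v)) = (algebraMap E (LocalRing E v)) ∘ c :=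
      funext fun y => conjLocal_algebraMap c v y
    rw [hJv, Matrix.map_map, hcφ, ← Matrix.map_map, ← Matrix.transpose_map, hJh]
  have hJvdet : Jv.det ≠ 0 := by
    rw [hJv, ← RingHom.mapMatrix_apply, ← RingHom.map_det]
    exact (_root_.map_ne_zero _).2 hJdet
  -- the quasi-symmetry family `M(μ) = 1 + ((μ - 1) q) • T₀` (inverse-free form of the engine's `Q(a, μ)`)
  haveI : Nonempty (Fin N) := ⟨⟨0, by omega⟩⟩
  obtain ⟨T₀, q, hmulM, hdetM, hunit⟩ := exists_quasi_family (σ := conjLocal E c v) hσ hθ hθ0 h2 Jv hJvh hJvdet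
  have hM1 : (1 + (((1 : LocalRing E v) - 1) * q) • T₀) = 1 := by
    rw [sub_self, zero_mul, zero_smul, add_zero]
  -- the section
  let S := LemD1OfPlace.standingData E v c N J hcδ hδ hN hJh hJdet
  have hz : ∀ z : S.normOne, conjLocal E c v ((z : (LocalRing E v)ˣ) : LocalRing E v) * ((z : (LocalRing E v)ˣ) : LocalRing E v) = 1 := by
    intro z
    rw [mul_comm]
    exact LemD1OfPlace.mul_conjLocal_eq_one E v c N J hcδ hδ hN hJh hJdet z
  let g : S.normOne → GL (Fin N) (LocalRing E v) := fun z =>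
    ⟨1 + ((((z : (LocalRing E v)ˣ) : LocalRing E v) - 1) * q) • T₀,
     1 + (((conjLocal E c v ((z : (LocalRing E v)ˣ) : LocalRing E v)) - 1) * q) • T₀,
     by rw [hmulM, mul_comm ((z : (LocalRing E v)ˣ) : LocalRing E v), hz, hM1], by rw [hmulM, hz, hM1]⟩
  have hgmem : ∀ z, g z ∈ S.U := by
    intro z
    rw [LemD1OfPlace.mem_U_iff, «local», mem_unitaryGroupOfForm_iff, hgram]
    exact hunit _ (hz z)
  refine ⟨fun z => ⟨g z, hgmem z⟩, ?_, fun z => Units.ext ?_⟩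
  · -- continuity: both `val` and `inv` are affine in `z` (resp. `z̄`)
    refine Continuous.subtype_mk ?_ _
    refine Units.continuous_iff.2 ⟨?_, ?_⟩
    · change Continuous fun z : S.normOne => (1 : Matrix (Fin N) (Fin N) (LocalRing E v)) +
        ((((z : (LocalRing E v)ˣ) : LocalRing E v) - 1) * q) • T₀
      have hval : Continuous fun z : S.normOne => ((z : (LocalRing E v)ˣ) : LocalRing E v) :=
        Units.continuous_val.comp continuous_subtype_val
      exact continuous_const.add (((hval.sub continuous_const).mul continuous_const).smul continuous_const)
    · change Continuous fun z : S.normOne => (1 : Matrix (Fin N) (Fin N) (LocalRing E v)) +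
        (((conjLocal E c v ((z : (LocalRing E v)ˣ) : LocalRing E v)) - 1) * q) • T₀
      have hval : Continuous fun z : S.normOne => conjLocal E c v ((z : (LocalRing E v)ˣ) : LocalRing E v) :=
        (continuous_conjLocal E c v).comp (Units.continuous_val.comp continuous_subtype_val)
      exact continuous_const.add (((hval.sub continuous_const).mul continuous_const).smul continuous_const)
  · rw [Matrix.GeneralLinearGroup.val_det_apply]
    exact hdetM _

/-! ## §2 Continuity transfer along the factorisation `Ψ = ψ ∘ det` -/

include hcδ in
/-- **`Ψ = ψ ∘ det` is continuous when `ψ` is** (EVERY place, every `N ≥ 2`: `det` is continuous). [cite: Mok2014, §1 Notation p. 5] -/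
theorem continuous_comp_det {A : Type*} [CommGroup A] [TopologicalSpace A]
    (Ψ : (LemD1OfPlace.standingData E v c N J hcδ hδ hN hJh hJdet).U →* A)
    (ψ : ↥(LemD1OfPlace.standingData E v c N J hcδ hδ hN hJh hJdet).normOne →* A)
    (hfac : ∀ (g : (LemD1OfPlace.standingData E v c N J hcδ hδ hN hJh hJdet).U)
      (hg : Matrix.GeneralLinearGroup.det (g : GL (Fin N) (LocalRing E v)) ∈
        (LemD1OfPlace.standingData E v c N J hcδ hδ hN hJh hJdet).normOne),
      Ψ g = ψ ⟨Matrix.GeneralLinearGroup.det (g : GL (Fin N) (LocalRing E v)), hg⟩)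
    (hψ : Continuous ψ) : Continuous Ψ := by
  have hmem := det_comp_subtype_mem_normOne E v c hcδ hδ N J hN hJh hJdet
  have heq : ⇑Ψ = fun g : (LemD1OfPlace.standingData E v c N J hcδ hδ hN hJh hJdet).U =>
      ψ ⟨Matrix.GeneralLinearGroup.det g.1, hmem g⟩ :=
    funext fun g => hfac g (hmem g)
  rw [heq]
  exact hψ.comp ((Matrix.GeneralLinearGroup.continuous_det.comp continuous_subtype_val).subtype_mk _)

include hcδ hδ hN hJh hJdet in
/-- **`ψ` is continuous when `Ψ = ψ ∘ det` is** (NON-SPLIT place, every `N ≥ 2`): `ψ = Ψ ∘ s` for the continuous section `s` of §1.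
[cite: Dieudonne1971GroupesClassiques, Chap. II §4] [cite: Mok2014, §1 Notation p. 5] -/
theorem continuous_of_factor {A : Type*} [CommGroup A] [TopologicalSpace A] (w : PlacesOver E v) (hw : c • w.1 = w.1)
    (Ψ : (LemD1OfPlace.standingData E v c N J hcδ hδ hN hJh hJdet).U →* A)
    (ψ : ↥(LemD1OfPlace.standingData E v c N J hcδ hδ hN hJh hJdet).normOne →* A)
    (hfac : ∀ (g : (LemD1OfPlace.standingData E v c N J hcδ hδ hN hJh hJdet).U)
      (hg : Matrix.GeneralLinearGroup.det (g : GL (Fin N) (LocalRing E v)) ∈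
        (LemD1OfPlace.standingData E v c N J hcδ hδ hN hJh hJdet).normOne),
      Ψ g = ψ ⟨Matrix.GeneralLinearGroup.det (g : GL (Fin N) (LocalRing E v)), hg⟩)
    (hΨ : Continuous Ψ) : Continuous ψ := by
  obtain ⟨s, hs, hdet⟩ := exists_continuous_det_section E v c hcδ hδ N J hN hJh hJdet w hw
  have hmem := det_comp_subtype_mem_normOne E v c hcδ hδ N J hN hJh hJdet
  have heq : ⇑ψ = fun z => Ψ (s z) := by
    funext z
    rw [hfac (s z) (hmem (s z))]
    congr 1
    exact (Subtype.ext (hdet z)).symm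
  rw [heq]
  exact hΨ.comp hs

end PlaceModel

/-! ## §3 Continuous characters of `U(V)(F_v)` = continuous characters of `E_v¹` ∘ `det` (non-split places, `N ≥ 3`) -/

section Diagonal

variable {F : Type} (E : Type) [Field F] [NumberField F] [Field E] [NumberField E] [Algebra F E]
  [Algebra.IsQuadraticExtension F E] (v : HeightOneSpectrum (𝓞 F)) (c : E ≃ₐ[F] E)
  {δ : E} (hcδ : c δ = -δ) (hδ : δ ≠ 0) {N : ℕ} (hN : 2 ≤ N) (hN3 : 3 ≤ N)
  (d : Fin N → E) (hJh : ((Matrix.diagonal d).map c)ᵀ = Matrix.diagonal d) (hJdet : (Matrix.diagonal d).det ≠ 0)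

include hN3 in
/-- **ANY quadratic `E/F`, diagonal `J`, `N ≥ 3`, NON-SPLIT place: for every CONTINUOUS `Ψ : U(V)(F_v) →* A` there is a UNIQUE `ψ : E_v¹ →* A`
with `Ψ = ψ ∘ det`, and it is CONTINUOUS.** [cite: Dieudonne1971GroupesClassiques, Chap. II §§4–5]
[cite: Liu2021, App. D §D.1 Step 3 (l. 5221) and Lemma D.1 (3) (l. 5233)] -/
theorem existsUnique_continuous_normOne_factor_of_diagonal {A : Type*} [CommGroup A] [TopologicalSpace A]
    (w : PlacesOver E v) (hw : c • w.1 = w.1)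
    (Ψ : (LemD1OfPlace.standingData E v c N (Matrix.diagonal d) hcδ hδ hN hJh hJdet).U →* A) (hΨ : Continuous Ψ) :
    ∃! ψ : ↥(LemD1OfPlace.standingData E v c N (Matrix.diagonal d) hcδ hδ hN hJh hJdet).normOne →* A,
      Continuous ψ ∧ ∀ (g : (LemD1OfPlace.standingData E v c N (Matrix.diagonal d) hcδ hδ hN hJh hJdet).U)
        (hg : Matrix.GeneralLinearGroup.det (g : GL (Fin N) (LocalRing E v)) ∈
          (LemD1OfPlace.standingData E v c N (Matrix.diagonal d) hcδ hδ hN hJh hJdet).normOne),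
        Ψ g = ψ ⟨Matrix.GeneralLinearGroup.det (g : GL (Fin N) (LocalRing E v)), hg⟩ := by
  obtain ⟨ψ, hψ, huniq⟩ := existsUnique_normOne_factor_of_diagonal E v c hcδ hδ hN hN3 d hJh hJdet w hw Ψ
  exact ⟨ψ, ⟨continuous_of_factor E v c hcδ hδ N (Matrix.diagonal d) hN hJh hJdet w hw Ψ ψ hψ hΨ, hψ⟩,
    fun ψ' hψ' => huniq ψ' hψ'.2⟩

end Diagonal

section CM

open Literature.NumberTheory.GelbartRogawski1991.UnitaryDualPair (imagUnit complexConj_imagUnit imagUnit_ne_zero)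

variable (L : Type) [Field L] [NumberField L] [IsCMField L]

local notation3 "cc" => (IsCMField.complexConj L)

variable (v : HeightOneSpectrum (𝓞 (maximalRealSubfield L))) {N : ℕ} (hN : 2 ≤ N) (hN3 : 3 ≤ N)
  (J : Matrix (Fin N) (Fin N) L) (hJh : (J.map (IsCMField.complexConj L))ᵀ = J) (hJdet : J.det ≠ 0)

include hN3 in
/-- **CM rows, ANY hermitian non-degenerate `J_N` (`N ≥ 3`), NON-SPLIT place of `L⁺`: for every CONTINUOUS `Ψ : U(V)(L⁺_v) →* A` there is a
UNIQUE `ψ : L_v¹ →* A` with `Ψ = ψ ∘ det`, and it is CONTINUOUS** — «continuous characters of `U(V)(L⁺_v)`» = «continuous characters of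
`L_v¹`» through `det`. [cite: Dieudonne1971GroupesClassiques, Chap. II §§4–5] [cite: Liu2021, App. D §D.1 Step 3 (l. 5221) and Lemma D.1 (3) (l. 5233)] -/
theorem existsUnique_continuous_normOne_factor_of_isCMField {A : Type*} [CommGroup A] [TopologicalSpace A]
    (w : PlacesOver L v) (hw : cc • w.1 = w.1)
    (Ψ : (LemD1OfPlace.standingData L v cc N J (complexConj_imagUnit L) (imagUnit_ne_zero L) hN hJh hJdet).U →* A)
    (hΨ : Continuous Ψ) :
    ∃! ψ : ↥(LemD1OfPlace.standingData L v cc N J (complexConj_imagUnit L) (imagUnit_ne_zero L) hN hJh hJdet).normOne →* A,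
      Continuous ψ ∧ ∀ (g : (LemD1OfPlace.standingData L v cc N J (complexConj_imagUnit L) (imagUnit_ne_zero L) hN hJh hJdet).U)
        (hg : Matrix.GeneralLinearGroup.det (g : GL (Fin N) (LocalRing L v)) ∈
          (LemD1OfPlace.standingData L v cc N J (complexConj_imagUnit L) (imagUnit_ne_zero L) hN hJh hJdet).normOne),
        Ψ g = ψ ⟨Matrix.GeneralLinearGroup.det (g : GL (Fin N) (LocalRing L v)), hg⟩ := by
  obtain ⟨ψ, hψ, huniq⟩ := existsUnique_normOne_factor_of_isCMField L v hN hN3 J hJh hJdet w hw Ψ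
  exact ⟨ψ, ⟨continuous_of_factor L v cc (complexConj_imagUnit L) (imagUnit_ne_zero L) N J hN hJh hJdet w hw Ψ ψ hψ hΨ, hψ⟩,
    fun ψ' hψ' => huniq ψ' hψ'.2⟩

end CM

end Literature.NumberTheory.Automorphic.Liu2021.LemD1IndexedNonVacuityCharacterDecisionAllRanksAbelianizationContinuous
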